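import Summits.CriticalPhenomena.PercolationContinuityZ3.Theorems.Transplant.LineGraphSiteContinuity
import Summits.CriticalPhenomena.PercolationContinuityZ3.Theorems.Transplant.LineGraphSiteScope
import Literature.Barriers.CriticalPhenomena.AmenableInvariantPercolationProofs
import HarnessLib

/-!
# Benjamini–Schramm's Conjecture 4 in its SITE form IMPLIES the BOND form: `BenjaminiSchramm1996_conj4_site → BenjaminiSchramm1996_conj4`
# (Fisher–Essam / Kesten Prop. 3.1 on the covering (line) graph) — the reduction the node census listed as 'no reduction typed'

builds on p205010 (kernel theorem, internal audit signed; external expert review pending) — nothing in this file uses p205010.  Lane `prim-bschramm`,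
seat `prim-bschramm-stmt` gen 37 (statements seat); helper file (`--supports stmt-CriticalPhenomena-4575 --as helper`); PROOFS ONLY (def-free).
NOTHING is claimed about any open node: both conjecture nodes stay OPEN; this file types the IMPLICATION between them.

THE POINT.  The tree carries Conjecture 4 in three spellings («StatementBenjaminiSchramm»): the bond form `BenjaminiSchramm1996_conj4` (quasi-transitive,
`p_c < 1 ⇒ θ_x(p_c) = 0`), its vertex-transitive case `…_conj4_transitive` (⟸ bond form, `conj4_transitive_of_conj4`), and Benjamini–Schramm's own SITE form
`…_conj4_site` (`p_c^{site} < 1 ⇒ θ^{site}_x(p_c^{site}) = 0`), so far with NO typed relation to the other two (§5 NODE CENSUS: 'OPEN (no reduction typed)').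
p2's Fisher–Essam device («Literature/…/LineGraphPercolation», «Transplant/LineGraphSiteContinuity» / «LineGraphSiteScope», gen 13) makes the relation a
one-page proof: Bernoulli SITE percolation on the line graph `L(G)` IS Bernoulli BOND percolation on `G` — `p_c^{site}(L(G), ṽ(e)) = p_c(G, v)` for every
end-vertex `v` of `e` (`siteCriticalProb_lineGraph_eq`), `p · θ_G(v, p) ≤ θ^{site}_{L(G)}(ṽ(e), p) ≤ θ_G(v, p)` (`mul_theta_le_siteTheta_lineGraph`,
`siteTheta_lineGraph_le_theta`), and `L(G)` inherits connectedness, local finiteness and quasi-transitivity (`lineGraph_connected`,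
`nonempty_lineGraph_locallyFinite`, `lineGraph_isQuasiTransitive`).  Hence:
* `theta_criticalProb_eq_zero_of_siteTheta_lineGraph` — the one-edge transfer AT CRITICALITY in the site-to-bond direction: `θ^{site}_{L(G)}(ṽ(e), p_c^{site}) = 0`
  at an edge `e ∋ v` gives `θ_G(v, p_c(G, v)) = 0` (the bond-to-site direction is p2's `lineGraph_siteCriticalContinuity_at`);
* **`conj4_of_conj4_site : BenjaminiSchramm1996_conj4_site → BenjaminiSchramm1996_conj4`** — apply the site conjecture to `L(G)` at an edge through `x`
  (one exists: `p_c(G, x) < 1` is impossible on a one-vertex graph — there `θ_x ≡ 0` and the conclusion holds outright — and otherwise connectedness gives a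
  first edge of a walk from `x`); `conj4_transitive_of_conj4_site` composes with `conj4_transitive_of_conj4`.
So the SITE form is the STRONGER statement in the tree's bookkeeping; the converse (bond ⇒ site) has no general device (Grimmett 1999 §1.6: site-to-bond
transformations do not exist in general) and is NOT claimed.  CENSUS EFFECT (§5 rows, no count change): `BenjaminiSchramm1996_conj4_site` now reads
'OPEN; ⟹ Conj. 4 (bond) by `conj4_of_conj4_site`', `BenjaminiSchramm1996_conj4` reads '… ⟸ the site form'.  Both nodes remain OPEN — a `Prop`, never asserted.
[cite: FisherEssam1961, §2] [cite: Kesten1982, §2.5 and §3.1 Prop. 3.1] [cite: GrimmettPercolation1999, §1.6 (bond and site models)]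
[cite: BenjaminiSchramm1996, Conj. 4 (p. 75); §2 ("Throughout the paper, site percolation is discussed")]
-/

noncomputable section

namespace Summit.CriticalPhenomena.PercolationContinuityZ3.Theorems.Transplant

open SimpleGraph MeasureTheory Literature.Probability.LatticeModels Literature.Probability.Percolation
open Literature.Barriers.CriticalPhenomena (IsQuasiTransitive countable_of_connected)
open scoped Classical

/-- **Site-to-bond transfer at criticality (one edge):** if site percolation on the line graph `L(G)` dies at its own critical point at the vertex `ṽ(e)`,
then bond percolation on `G` dies at its own critical point at every end-vertex `v` of `e` — `p_c^{site}(L(G), ṽ(e)) = p_c(G, v)` (Fisher–Essam) and Harris'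
bound `p · θ_G(v, p) ≤ θ^{site}_{L(G)}(ṽ(e), p)`; at `p_c = 0` the conclusion is `theta_bot`.  Converse direction: `lineGraph_siteCriticalContinuity_at`.
[cite: Kesten1982, §3.1 Prop. 3.1] [cite: FisherEssam1961, §2] -/
theorem theta_criticalProb_eq_zero_of_siteTheta_lineGraph {V : Type} [Countable V] {G : SimpleGraph V} (e : G.edgeSet) {v : V}
    (hv : v ∈ (e : Sym2 V)) (h : siteTheta G.lineGraph e (siteCriticalProbIOf G.lineGraph e) = 0) :
    theta G v (criticalProbIOf G v) = 0 := by
  rw [siteCriticalProbIOf_lineGraph_eq e hv] at h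
  have hle := mul_theta_le_siteTheta_lineGraph e hv (criticalProbIOf G v)
  rw [h] at hle
  by_cases h0 : (criticalProbIOf G v : ℝ) = 0
  · have : criticalProbIOf G v = 0 := Subtype.ext h0
    rw [this]
    exact theta_bot G v
  · have hpos : 0 < (criticalProbIOf G v : ℝ) := lt_of_le_of_ne (criticalProbIOf G v).2.1 (Ne.symm h0)
    have hθ : theta G v (criticalProbIOf G v) ≤ 0 := by
      by_contra hcon
      push Not at hcon
      exact absurd hle (not_le.2 (mul_pos hpos hcon))
    exact le_antisymm hθ measureReal_nonneg

/-- **Benjamini–Schramm's Conjecture 4 in its SITE form implies the BOND form** (both OPEN; this is the implication only): given a connected, locally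
finite, quasi-transitive `G` and `x` with `p_c(G, x) < 1`, either `G` is the one-vertex graph (then `θ_x ≡ 0`, `theta_eq_zero_of_finite`) or `x` lies on an
edge `e`, and the site conjecture applied to the connected, locally finite, quasi-transitive line graph `L(G)` at `ṽ(e)` (`p_c^{site}(L(G), ṽ(e)) = p_c(G, x) < 1`)
transfers back by `theta_criticalProb_eq_zero_of_siteTheta_lineGraph`. [cite: BenjaminiSchramm1996, Conj. 4; §2] [cite: Kesten1982, §3.1 Prop. 3.1]
[cite: FisherEssam1961, §2] -/
theorem conj4_of_conj4_site (h : BenjaminiSchramm1996_conj4_site) : BenjaminiSchramm1996_conj4 := by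
  intro V G _ hc hq x hpc
  haveI : Countable V := countable_of_connected hc
  by_cases hV : ∃ y : V, y ≠ x
  · obtain ⟨y, hy⟩ := hV
    obtain ⟨w⟩ := hc.preconnected x y
    have hadj : ∃ z, G.Adj x z := by
      cases w with
      | nil => exact absurd rfl hy
      | cons hxz _ => exact ⟨_, hxz⟩
    obtain ⟨z, hxz⟩ := hadj
    let e : G.edgeSet := ⟨s(x, z), (mem_edgeSet G).2 hxz⟩
    have hxe : x ∈ (e : Sym2 V) := Sym2.mem_mk_left x z
    haveI : G.lineGraph.LocallyFinite := nonempty_lineGraph_locallyFinite.some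
    have hpc' : siteCriticalProb G.lineGraph e < 1 := by
      rw [siteCriticalProb_lineGraph_eq e hxe]; exact hpc
    exact theta_criticalProb_eq_zero_of_siteTheta_lineGraph e hxe
      (h G.lineGraph (lineGraph_connected hc e) (lineGraph_isQuasiTransitive hq) e hpc')
  · push Not at hV
    haveI : Subsingleton V := ⟨fun a b => (hV a).trans (hV b).symm⟩
    exact theta_eq_zero_of_finite G x _

/-- The site form of Conjecture 4 implies the vertex-transitive bond form (`conj4_transitive_of_conj4 ∘ conj4_of_conj4_site`).
[cite: BenjaminiSchramm1996, Conj. 4; §2 (transitive graphs)] -/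
theorem conj4_transitive_of_conj4_site (h : BenjaminiSchramm1996_conj4_site) : BenjaminiSchramm1996_conj4_transitive :=
  conj4_transitive_of_conj4 (conj4_of_conj4_site h)

end Summit.CriticalPhenomena.PercolationContinuityZ3.Theorems.Transplant

end
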